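import Summits.AtomisticToContinuum.FouriersLaw.Theorems.HonestZwanzigNetworkReductionLimits
import Summits.AtomisticToContinuum.FouriersLaw.Theorems.HonestZwanzigGeneratorSiteEnergy

/-!
# HonestZwanzig / PositiveMemory — Kirchhoff flatness of the unprojected DC responses (line `Sketch`, Stub R)

Support file for item `stmt-AtomisticToContinuum-12694` (`PositiveMemory` of route `HonestZwanzig`, sub-problem
`FouriersLaw`), line `Sketch` v8, registered stub `stub_rowLimit`: at fixed `N ≥ 2`, for every genuine bond `b`
(`b + 1 < N`), `lap_s(j_b, J) → ∫₀^∞corr(J,J)/(N−1)` as `s ↓ 0` — the UNPROJECTED zero-frequency response of the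
bond current to the total current is the same number on every bond (by the Kundu–Dhar–Narayan identity it is
`T²D_N`, the response coefficient of the open chain).

Proof. Fix `s > 0`. For an interior site `y` (`1 ≤ y ≤ N − 2`) the time-reversed generator of the split site
energy is `(L e_y)∘Θ = j_y − j_{y−1}` (no bath term), so by first-slot linearity (`pkg_Lr_lap`) and the first
Kolmogorov identity against the current (`pkg_K4`)
`lap_s(j_y, J) − lap_s(j_{y−1}, J) = lap_s((L e_y)∘Θ, J) = −s·lap_s(J, e_y)`.
Telescoping from the left contact bond, `lap_s(j_b, J) = lap_s(j_0, J) − s·Σ_{1 ≤ y ≤ b} lap_s(J, e_y)` for every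
genuine bond, and summing over the `N − 1` genuine bonds (`Σ_b lap_s(j_b, J) = lap_s(J, J)`, `pkg_J_lap`; the phantom
bond carries no current, `pkg_j_last`) gives
`(N−1)·lap_s(j_b, J) = lap_s(J,J) + s·E_b(s)`, `E_b(s)` an integer combination of the `lap_s(J, e_y)`, which are
bounded by `∫₀^∞|corr(J, e_y)|` uniformly in `s ≥ 0`. Hence `lap_s(j_b,J) − lap_s(J,J)/(N−1) = O(s)` and the claim
follows from `lap_s(J,J) → ∫₀^∞corr(J,J)` (`tendsto_lap_totalCurrent`).

* `RowLimit.bond_step`, `RowLimit.bond_telescope`, `RowLimit.bond_identity` — the fixed-`s` algebra for the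
  canonical gadgets (implicit variables with defining hypotheses, as in the `NetworkReduction` package);
* `RowLimit.abs_lap_le` — `|lap_s(f,g)| ≤ ∫₀^∞|corr(f,g)|` for admissible `f, g`, `s ≥ 0`;
* `RowLimit.tendsto_lap_bond` — the limit for the canonical gadgets;
* `stub_rowLimit` — the registered stub (verbatim signature), `FeshbachIdentities` as antecedent,
  `GeneratorSiteEnergy` discharged by the landed `generatorSiteEnergy_proof`.

No definitions, no named facts.
-/

noncomputable section

open MeasureTheory Finset Real Set Filter Topology
open Literature.MathematicalPhysics.KineticTheory.HeatConduction
open Summit.AtomisticToContinuum.FouriersLaw.Theorems.HonestZwanzig.NetworkReduction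

namespace Summit.AtomisticToContinuum.FouriersLaw.Theorems.HonestZwanzig.PositiveMemory

namespace RowLimit

section Package

variable {ω₂ lam β γ : ℝ} {N : ℕ} {T : ℝ}
  {Adm : (PhaseSpace N → ℝ) → Prop}
  {corr : (PhaseSpace N → ℝ) → (PhaseSpace N → ℝ) → ℝ → ℝ}
  {lap : ℝ → (PhaseSpace N → ℝ) → (PhaseSpace N → ℝ) → ℝ}
  {cov : (PhaseSpace N → ℝ) → (PhaseSpace N → ℝ) → ℝ}
  {e : Fin N → PhaseSpace N → ℝ}
  (hAdm : ∀ f, Adm f ↔ (Continuous f ∧ ∃ A : ℝ, ∀ z,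
    |f z| ≤ A * Real.exp ((pinnedChain ω₂ lam β γ).hamiltonian N z / (8 * T))))
  (hcorr : ∀ f g t, corr f g t =
    (∫ z, f z * (∫ y, g y ∂((pinnedChain ω₂ lam β γ).transitionKernel N T T t.toNNReal z))
      ∂(pinnedChain ω₂ lam β γ).gibbsMeasure N T) -
    (∫ z, f z ∂(pinnedChain ω₂ lam β γ).gibbsMeasure N T) *
      (∫ z, g z ∂(pinnedChain ω₂ lam β γ).gibbsMeasure N T))
  (hlap : ∀ s f g, lap s f g = ∫ t in Set.Ioi (0 : ℝ), Real.exp (-(s * t)) * corr f g t)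
  (hcov : ∀ f g, cov f g = (∫ z, f z * g z ∂(pinnedChain ω₂ lam β γ).gibbsMeasure N T) -
    (∫ z, f z ∂(pinnedChain ω₂ lam β γ).gibbsMeasure N T) *
      (∫ z, g z ∂(pinnedChain ω₂ lam β γ).gibbsMeasure N T))
  (he : ∀ x z, e x z = z.2 x ^ 2 / 2 + (pinnedChain ω₂ lam β γ).U (z.1 x) +
    ∑ j : Fin N, ((if j.val = x.val + 1 then (pinnedChain ω₂ lam β γ).V (z.1 j - z.1 x) / 2 else 0) +
      (if x.val = j.val + 1 then (pinnedChain ω₂ lam β γ).V (z.1 x - z.1 j) / 2 else 0)))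
  (hFI : ∀ f g : PhaseSpace N → ℝ, Adm f → Adm g →
    Integrable f ((pinnedChain ω₂ lam β γ).gibbsMeasure N T) ∧
    (∀ t : ℝ, 0 ≤ t → Integrable (fun z => f z *
      (∫ y, g y ∂((pinnedChain ω₂ lam β γ).transitionKernel N T T t.toNNReal z)))
      ((pinnedChain ω₂ lam β γ).gibbsMeasure N T)) ∧
    IntegrableOn (corr f g) (Set.Ioi 0) ∧
    (∀ t : ℝ, 0 ≤ t → corr f g t = corr (fun z => g (z.1, -z.2)) (fun z => f (z.1, -z.2)) t) ∧
    (∀ s : ℝ, 0 < s → ∀ x : Fin N,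
      s * lap s (e x) g - cov (e x) g =
        lap s (fun z => (pinnedChain ω₂ lam β γ).generator N T T (e x) (z.1, -z.2)) g ∧
      s * lap s f (e x) - cov f (e x) = lap s f ((pinnedChain ω₂ lam β γ).generator N T T (e x))))
  (hGSE : ∀ (x : Fin N) (z : PhaseSpace N), (pinnedChain ω₂ lam β γ).generator N T T (e x) z =
    (∑ b : Fin N, ((if x.val = b.val + 1 then (pinnedChain ω₂ lam β γ).bondCurrent N b z else 0) -
      (if b = x then (pinnedChain ω₂ lam β γ).bondCurrent N b z else 0))) +
    (if x.val = 0 then (pinnedChain ω₂ lam β γ).γ * (T - z.2 x ^ 2) else 0) +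
    (if x.val = N - 1 then (pinnedChain ω₂ lam β γ).γ * (T - z.2 x ^ 2) else 0))
  (hω : 0 < ω₂) (hl : 0 ≤ lam) (hβ : 0 ≤ β) (hγ : 0 ≤ γ) (hT : 0 < T)

include hlap hFI in
/-- `|lap_s(f, g)| ≤ ∫₀^∞ |corr(f,g)|` for admissible `f, g` and `s ≥ 0` (`0 < e^{-st} ≤ 1`). -/
theorem abs_lap_le {f g : PhaseSpace N → ℝ} (hf : Adm f) (hg : Adm g) {s : ℝ} (hs : 0 ≤ s) :
    |lap s f g| ≤ ∫ t in Set.Ioi (0 : ℝ), |corr f g t| := by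
  have hI : IntegrableOn (corr f g) (Set.Ioi 0) := (hFI f g hf hg).2.2.1
  rw [hlap, ← Real.norm_eq_abs]
  have hI' : Integrable (fun t => |corr f g t|) (volume.restrict (Set.Ioi 0)) := hI.abs
  refine norm_integral_le_of_norm_le hI' ?_
  filter_upwards [ae_restrict_mem measurableSet_Ioi] with t ht
  rw [norm_mul, Real.norm_eq_abs, Real.norm_eq_abs, abs_of_pos (Real.exp_pos _)]
  have h1 : Real.exp (-(s * t)) ≤ 1 := by
    rw [← Real.exp_zero]
    exact Real.exp_le_exp.mpr (by nlinarith [mul_nonneg hs (le_of_lt (show (0 : ℝ) < t from ht))])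
  calc Real.exp (-(s * t)) * |corr f g t| ≤ 1 * |corr f g t| :=
      mul_le_mul_of_nonneg_right h1 (abs_nonneg _)
    _ = |corr f g t| := one_mul _

include hAdm hcorr hlap hcov he hFI hGSE hω hl hβ hγ hT in
/-- **The interior step.** For an interior site `y` (`1 ≤ y`, `y + 1 < N`) and `s > 0`:
`lap_s(j_y, J) − lap_s(j_{y−1}, J) = −s·lap_s(J, e_y)`. -/
theorem bond_step {s : ℝ} (hs : 0 < s) (y : Fin N) (hy0 : 0 < y.val) (hy1 : y.val + 1 < N)
    (y' : Fin N) (hy' : y.val = y'.val + 1) :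
    lap s ((pinnedChain ω₂ lam β γ).bondCurrent N y)
        (fun z => ∑ i : Fin N, (pinnedChain ω₂ lam β γ).bondCurrent N i z) -
      lap s ((pinnedChain ω₂ lam β γ).bondCurrent N y')
        (fun z => ∑ i : Fin N, (pinnedChain ω₂ lam β γ).bondCurrent N i z) =
      -(s * lap s (fun z => ∑ i : Fin N, (pinnedChain ω₂ lam β γ).bondCurrent N i z) (e y)) := by
  have hJ : Adm (fun z => ∑ i : Fin N, (pinnedChain ω₂ lam β γ).bondCurrent N i z) :=
    adm_totalCurrent Adm hAdm hω hl hβ hT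
  have hLr := pkg_Lr_lap hAdm hcorr hlap hFI hGSE hω hl hβ hγ hT hs.le y hJ
  have hK4 := pkg_K4 hAdm hcorr hlap hcov he hFI hGSE hω hl hβ hT hs y
  rw [hLr] at hK4
  have hne0 : y.val ≠ 0 := by omega
  have hneN : y.val ≠ N - 1 := by omega
  rw [if_neg hne0, if_neg hneN, add_zero, mul_zero, neg_zero, zero_mul, add_zero] at hK4
  -- the two indicator sums
  have hsum1 : ∑ b : Fin N, ((if b = y then (1 : ℝ) else 0) - (if y.val = b.val + 1 then 1 else 0)) *
      lap s ((pinnedChain ω₂ lam β γ).bondCurrent N b)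
        (fun z => ∑ i : Fin N, (pinnedChain ω₂ lam β γ).bondCurrent N i z) =
      lap s ((pinnedChain ω₂ lam β γ).bondCurrent N y)
        (fun z => ∑ i : Fin N, (pinnedChain ω₂ lam β γ).bondCurrent N i z) -
      lap s ((pinnedChain ω₂ lam β γ).bondCurrent N y')
        (fun z => ∑ i : Fin N, (pinnedChain ω₂ lam β γ).bondCurrent N i z) := by
    simp only [sub_mul, Finset.sum_sub_distrib, ite_mul, one_mul, zero_mul]
    rw [Finset.sum_ite_eq' Finset.univ y, if_pos (Finset.mem_univ _)]
    congr 1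
    rw [Finset.sum_eq_single y']
    · rw [if_pos hy']
    · intro b _ hb
      rw [if_neg]
      intro h
      apply hb
      apply Fin.ext
      omega
    · intro h
      exact absurd (Finset.mem_univ _) h
  rw [hsum1] at hK4
  exact hK4

include hAdm hcorr hlap hcov he hFI hGSE hω hl hβ hγ hT in
/-- **Telescoping from the left contact bond.** For `s > 0` and every genuine bond index `n` (`n + 1 < N`):
`lap_s(j_n, J) = lap_s(j_0, J) − s·Σ_{m < n} lap_s(J, e_{m+1})` (written with `ℕ`-indexed bookkeeping
functions that vanish off `[0, N)`). -/
theorem bond_telescope {s : ℝ} (hs : 0 < s)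
    (U A : ℕ → ℝ)
    (hU : ∀ (m : ℕ) (hm : m < N), U m = lap s ((pinnedChain ω₂ lam β γ).bondCurrent N ⟨m, hm⟩)
      (fun z => ∑ i : Fin N, (pinnedChain ω₂ lam β γ).bondCurrent N i z))
    (hA : ∀ (m : ℕ) (hm : m < N), A m =
      lap s (fun z => ∑ i : Fin N, (pinnedChain ω₂ lam β γ).bondCurrent N i z) (e ⟨m, hm⟩)) :
    ∀ n : ℕ, n + 1 < N → U n = U 0 - s * ∑ m ∈ Finset.range n, A (m + 1) := by
  intro n
  induction n with
  | zero =>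
    intro _
    simp
  | succ n ih =>
    intro hn
    have hnN : n + 1 < N := by omega
    have hstep := bond_step hAdm hcorr hlap hcov he hFI hGSE hω hl hβ hγ hT hs ⟨n + 1, hn.le.trans_lt' (by omega)⟩
      (by simp) (by simpa using hn) ⟨n, by omega⟩ rfl
    rw [← hU (n + 1) (by omega), ← hU n (by omega), ← hA (n + 1) (by omega)] at hstep
    rw [Finset.sum_range_succ, mul_add]
    have := ih hnN
    linarith

include hAdm hcorr hlap hcov he hFI hGSE hω hl hβ hγ hT in
/-- **The fixed-`s` Kirchhoff identity.** For `N ≥ 2`, `s > 0` and every genuine bond index `n`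
(`n + 1 < N`): `(N−1)·lap_s(j_n, J) = lap_s(J,J) + s·E_n(s)` with
`E_n(s) = Σ_{m < N−1} Σ_{i < m} A(i+1) − (N−1)·Σ_{i<n} A(i+1)`, `A(m) = lap_s(J, e_m)`. -/
theorem bond_identity (hN : 2 ≤ N) {s : ℝ} (hs : 0 < s)
    (U A : ℕ → ℝ)
    (hU : ∀ (m : ℕ) (hm : m < N), U m = lap s ((pinnedChain ω₂ lam β γ).bondCurrent N ⟨m, hm⟩)
      (fun z => ∑ i : Fin N, (pinnedChain ω₂ lam β γ).bondCurrent N i z))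
    (hA : ∀ (m : ℕ) (hm : m < N), A m =
      lap s (fun z => ∑ i : Fin N, (pinnedChain ω₂ lam β γ).bondCurrent N i z) (e ⟨m, hm⟩))
    (n : ℕ) (hn : n + 1 < N) :
    ((N : ℝ) - 1) * U n =
      lap s (fun z => ∑ i : Fin N, (pinnedChain ω₂ lam β γ).bondCurrent N i z)
          (fun z => ∑ i : Fin N, (pinnedChain ω₂ lam β γ).bondCurrent N i z) +
        s * ((∑ m ∈ Finset.range (N - 1), ∑ i ∈ Finset.range m, A (i + 1)) -
          ((N : ℝ) - 1) * ∑ i ∈ Finset.range n, A (i + 1)) := by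
  have hJ : Adm (fun z => ∑ i : Fin N, (pinnedChain ω₂ lam β γ).bondCurrent N i z) :=
    adm_totalCurrent Adm hAdm hω hl hβ hT
  have htel := bond_telescope hAdm hcorr hlap hcov he hFI hGSE hω hl hβ hγ hT hs U A hU hA
  -- `lap_s(J,J) = Σ_{m < N} U m = Σ_{m < N-1} U m`
  have hJJ : lap s (fun z => ∑ i : Fin N, (pinnedChain ω₂ lam β γ).bondCurrent N i z)
      (fun z => ∑ i : Fin N, (pinnedChain ω₂ lam β γ).bondCurrent N i z) =
      ∑ m ∈ Finset.range (N - 1), U m := by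
    rw [pkg_J_lap hAdm hcorr hlap hFI hω hl hβ hT hs.le hJ]
    have h1 : ∑ b : Fin N, lap s ((pinnedChain ω₂ lam β γ).bondCurrent N b)
        (fun z => ∑ i : Fin N, (pinnedChain ω₂ lam β γ).bondCurrent N i z) = ∑ m ∈ Finset.range N, U m := by
      rw [← Fin.sum_univ_eq_sum_range]
      exact Finset.sum_congr rfl fun b _ => (hU b.val b.isLt).symm
    rw [h1]
    obtain ⟨M, rfl⟩ : ∃ M, N = M + 1 := ⟨N - 1, by omega⟩
    rw [Finset.sum_range_succ, Nat.add_sub_cancel]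
    have hlast : U M = 0 := by
      rw [hU M (by omega)]
      exact pkg_j_last hcorr hlap s ⟨M, by omega⟩ (by simp) _
    rw [hlast, add_zero]
  -- substitute the telescoped form of every `U m`, `m < N - 1`
  have hsumU : ∑ m ∈ Finset.range (N - 1), U m =
      ((N : ℝ) - 1) * U 0 - s * ∑ m ∈ Finset.range (N - 1), ∑ i ∈ Finset.range m, A (i + 1) := by
    rw [Finset.mul_sum, Finset.sum_congr rfl fun m hm => htel m (by
      have := Finset.mem_range.mp hm; omega), Finset.sum_sub_distrib, Finset.sum_const, Finset.card_range,
      nsmul_eq_mul]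
    have hc : ((N - 1 : ℕ) : ℝ) = (N : ℝ) - 1 := by
      rw [Nat.cast_sub (by omega)]
      simp
    rw [hc]
  have hUn := htel n hn
  rw [hJJ, hsumU, hUn]
  ring

include hAdm hcorr hlap hcov he hFI hGSE hω hl hβ hγ hT in
/-- **Kirchhoff flatness in the limit `s ↓ 0`** for the canonical gadgets: for every genuine bond `b`,
`lap_s(j_b, J) → ∫₀^∞corr(J,J)/(N−1)`. -/
theorem tendsto_lap_bond (hN : 2 ≤ N) (b : Fin N) (hb : b.val + 1 < N) :
    Tendsto (fun s => lap s ((pinnedChain ω₂ lam β γ).bondCurrent N b)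
        (fun z => ∑ i : Fin N, (pinnedChain ω₂ lam β γ).bondCurrent N i z))
      (nhdsWithin (0 : ℝ) (Set.Ioi 0))
      (nhds ((∫ t in Set.Ioi (0 : ℝ), corr (fun z => ∑ i : Fin N, (pinnedChain ω₂ lam β γ).bondCurrent N i z)
        (fun z => ∑ i : Fin N, (pinnedChain ω₂ lam β γ).bondCurrent N i z) t) / ((N : ℝ) - 1))) := by
  set J : PhaseSpace N → ℝ := fun z => ∑ i : Fin N, (pinnedChain ω₂ lam β γ).bondCurrent N i z with hJdef
  have hJ : Adm J := adm_totalCurrent Adm hAdm hω hl hβ hT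
  have hex : ∀ x, Adm (e x) := fun x => adm_e Adm hAdm e he hω hl hβ hT x
  have hN1 : (0 : ℝ) < (N : ℝ) - 1 := by
    have : (2 : ℝ) ≤ N := by exact_mod_cast hN
    linarith
  -- the `s`-dependent bookkeeping functions
  set U : ℝ → ℕ → ℝ := fun s m => if hm : m < N then
    lap s ((pinnedChain ω₂ lam β γ).bondCurrent N ⟨m, hm⟩) J else 0 with hUdef
  set A : ℝ → ℕ → ℝ := fun s m => if hm : m < N then lap s J (e ⟨m, hm⟩) else 0 with hAdef
  have hU : ∀ s (m : ℕ) (hm : m < N), U s m = lap s ((pinnedChain ω₂ lam β γ).bondCurrent N ⟨m, hm⟩) J := by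
    intro s m hm
    simp only [hUdef, dif_pos hm]
  have hA : ∀ s (m : ℕ) (hm : m < N), A s m = lap s J (e ⟨m, hm⟩) := by
    intro s m hm
    simp only [hAdef, dif_pos hm]
  set E : ℝ → ℝ := fun s => (∑ m ∈ Finset.range (N - 1), ∑ i ∈ Finset.range m, A s (i + 1)) -
    ((N : ℝ) - 1) * ∑ i ∈ Finset.range b.val, A s (i + 1) with hEdef
  -- a uniform bound on `A s m`, `s ≥ 0`
  set B : ℝ := ∑ y : Fin N, ∫ t in Set.Ioi (0 : ℝ), |corr J (e y) t| with hBdef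
  have hB0 : 0 ≤ B := Finset.sum_nonneg fun y _ => integral_nonneg fun t => abs_nonneg _
  have hAB : ∀ s, 0 ≤ s → ∀ m, |A s m| ≤ B := by
    intro s hs m
    by_cases hm : m < N
    · rw [hA s m hm]
      calc |lap s J (e ⟨m, hm⟩)| ≤ ∫ t in Set.Ioi (0 : ℝ), |corr J (e ⟨m, hm⟩) t| :=
            abs_lap_le hlap hFI hJ (hex _) hs
        _ ≤ B := by
            rw [hBdef]
            exact Finset.single_le_sum (f := fun y => ∫ t in Set.Ioi (0 : ℝ), |corr J (e y) t|)
              (fun y _ => integral_nonneg fun t => abs_nonneg _) (Finset.mem_univ (⟨m, hm⟩ : Fin N))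
    · simp only [hAdef, dif_neg hm, abs_zero]
      exact hB0
  -- hence a uniform bound on `E s`
  have hEB : ∀ s, 0 ≤ s → |E s| ≤ (N : ℝ) * (N : ℝ) * B + ((N : ℝ) - 1) * (N : ℝ) * B := by
    intro s hs
    have h1 : |∑ m ∈ Finset.range (N - 1), ∑ i ∈ Finset.range m, A s (i + 1)| ≤ (N : ℝ) * (N : ℝ) * B := by
      calc |∑ m ∈ Finset.range (N - 1), ∑ i ∈ Finset.range m, A s (i + 1)|
          ≤ ∑ m ∈ Finset.range (N - 1), |∑ i ∈ Finset.range m, A s (i + 1)| := Finset.abs_sum_le_sum_abs _ _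
        _ ≤ ∑ m ∈ Finset.range (N - 1), ((N : ℝ) * B) := by
            refine Finset.sum_le_sum fun m hm => ?_
            have hmN : m < N := by have := Finset.mem_range.mp hm; omega
            calc |∑ i ∈ Finset.range m, A s (i + 1)| ≤ ∑ i ∈ Finset.range m, |A s (i + 1)| :=
                  Finset.abs_sum_le_sum_abs _ _
              _ ≤ ∑ i ∈ Finset.range m, B := Finset.sum_le_sum fun i _ => hAB s hs _
              _ = (m : ℝ) * B := by rw [Finset.sum_const, Finset.card_range, nsmul_eq_mul]
              _ ≤ (N : ℝ) * B := by
                  have : (m : ℝ) ≤ N := by exact_mod_cast hmN.le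
                  exact mul_le_mul_of_nonneg_right this hB0
        _ = ((N - 1 : ℕ) : ℝ) * ((N : ℝ) * B) := by rw [Finset.sum_const, Finset.card_range, nsmul_eq_mul]
        _ ≤ (N : ℝ) * ((N : ℝ) * B) := by
            have : ((N - 1 : ℕ) : ℝ) ≤ N := by exact_mod_cast Nat.sub_le N 1
            exact mul_le_mul_of_nonneg_right this (by positivity)
        _ = (N : ℝ) * (N : ℝ) * B := by ring
    have h2 : |((N : ℝ) - 1) * ∑ i ∈ Finset.range b.val, A s (i + 1)| ≤ ((N : ℝ) - 1) * (N : ℝ) * B := by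
      rw [abs_mul, abs_of_pos hN1, mul_assoc]
      refine mul_le_mul_of_nonneg_left ?_ hN1.le
      calc |∑ i ∈ Finset.range b.val, A s (i + 1)| ≤ ∑ i ∈ Finset.range b.val, |A s (i + 1)| :=
            Finset.abs_sum_le_sum_abs _ _
        _ ≤ ∑ i ∈ Finset.range b.val, B := Finset.sum_le_sum fun i _ => hAB s hs _
        _ = (b.val : ℝ) * B := by rw [Finset.sum_const, Finset.card_range, nsmul_eq_mul]
        _ ≤ (N : ℝ) * B := by
            have : (b.val : ℝ) ≤ N := by exact_mod_cast b.isLt.le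
            exact mul_le_mul_of_nonneg_right this hB0
    calc |E s| ≤ |∑ m ∈ Finset.range (N - 1), ∑ i ∈ Finset.range m, A s (i + 1)| +
          |((N : ℝ) - 1) * ∑ i ∈ Finset.range b.val, A s (i + 1)| := abs_sub _ _
      _ ≤ _ := add_le_add h1 h2
  -- the fixed-`s` identity, for every `s > 0`
  have hid : ∀ s, 0 < s → lap s ((pinnedChain ω₂ lam β γ).bondCurrent N b) J =
      lap s J J / ((N : ℝ) - 1) + s * E s / ((N : ℝ) - 1) := by
    intro s hs
    have h := bond_identity hAdm hcorr hlap hcov he hFI hGSE hω hl hβ hγ hT hN hs (U s) (A s) (hU s) (hA s)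
      b.val hb
    rw [hU s b.val b.isLt] at h
    have hb' : (⟨b.val, b.isLt⟩ : Fin N) = b := Fin.ext rfl
    rw [hb', ← hJdef] at h
    have hE : E s = (∑ m ∈ Finset.range (N - 1), ∑ i ∈ Finset.range m, A s (i + 1)) -
        ((N : ℝ) - 1) * ∑ i ∈ Finset.range b.val, A s (i + 1) := rfl
    rw [← hE] at h
    field_simp
    linarith [h]
  -- pass to the limit
  have hlapJJ := tendsto_lap_totalCurrent hAdm hlap hFI hω hl hβ hT (corr := corr)
  have hmain : Tendsto (fun s => lap s J J / ((N : ℝ) - 1) + s * E s / ((N : ℝ) - 1))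
      (nhdsWithin (0 : ℝ) (Set.Ioi 0))
      (nhds ((∫ t in Set.Ioi (0 : ℝ), corr J J t) / ((N : ℝ) - 1) + 0)) := by
    refine (hlapJJ.div_const _).add ?_
    -- `s * E s / (N-1) → 0`: bounded times vanishing
    set M : ℝ := (N : ℝ) * (N : ℝ) * B + ((N : ℝ) - 1) * (N : ℝ) * B with hMdef
    have hsmall : Tendsto (fun s : ℝ => |s| * (M / ((N : ℝ) - 1))) (nhdsWithin (0 : ℝ) (Set.Ioi 0)) (nhds 0) := by
      have hc : Continuous fun s : ℝ => |s| * (M / ((N : ℝ) - 1)) := by fun_prop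
      have := (hc.tendsto 0).mono_left (nhdsWithin_le_nhds (s := Set.Ioi (0 : ℝ)))
      simpa using this
    refine squeeze_zero_norm' ?_ hsmall
    filter_upwards [self_mem_nhdsWithin] with s hs
    have hs0 : 0 < s := hs
    rw [Real.norm_eq_abs, abs_div, abs_mul, abs_of_pos hN1]
    rw [div_le_iff₀ hN1]
    have : |s| * (M / ((N : ℝ) - 1)) * ((N : ℝ) - 1) = |s| * M := by
      field_simp
    rw [this]
    exact mul_le_mul_of_nonneg_left (hEB s hs0.le) (abs_nonneg _)
  rw [add_zero] at hmain
  refine hmain.congr' ?_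
  filter_upwards [self_mem_nhdsWithin] with s hs
  exact (hid s hs).symm

end Package

end RowLimit

/-- **Stub R — Kirchhoff flatness of the unprojected DC responses** (registered v8; fixed `N`, from the
`FeshbachIdentities` package and `GeneratorSiteEnergy`): for every genuine bond `b` (`b + 1 < N`),
`lap_s(j_b, J) → ∫₀^∞corr(J,J)/(N−1)` as `s ↓ 0`. At fixed `s > 0` the interior Kolmogorov identities
`lap_s(j_y, J) − lap_s(j_{y−1}, J) = lap_s((L e_y)∘Θ, J) = −s·lap_s(J, e_y)` (`1 ≤ y ≤ N−2`; `pkg_Lr_lap`, `pkg_K4`) give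
`(N−1)·lap_s(j_b, J) = lap_s(J,J) + s·Σ_y c_{b,y} lap_s(J, e_y)` with integer `c_{b,y}` and `|lap_s(J,e_y)| ≤ ∫₀^∞|corr(J,e_y)|`;
then `tendsto_lap_totalCurrent`. The unprojected response is the same number (`= T²D_N`) on EVERY bond. -/
theorem stub_rowLimit :
    Summit.AtomisticToContinuum.FouriersLaw.Theses.HonestZwanzig.FeshbachIdentities →
    ∀ ω₂ lam β γ : ℝ, 0 < ω₂ → 0 < lam → 0 < β → 0 < γ → ∀ T : ℝ, 0 < T → ∀ N : ℕ, 2 ≤ N →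
    let P := Literature.MathematicalPhysics.KineticTheory.HeatConduction.pinnedChain ω₂ lam β γ;
    let X := Literature.MathematicalPhysics.KineticTheory.HeatConduction.PhaseSpace N;
    let μ : MeasureTheory.Measure X := P.gibbsMeasure N T;
    let corr : (X → ℝ) → (X → ℝ) → ℝ → ℝ := fun f g t =>
      (∫ z, f z * (∫ y, g y ∂(P.transitionKernel N T T t.toNNReal z)) ∂μ) - (∫ z, f z ∂μ) * (∫ z, g z ∂μ);
    let lap : ℝ → (X → ℝ) → (X → ℝ) → ℝ := fun s f g =>
      ∫ t in Set.Ioi (0 : ℝ), Real.exp (-(s * t)) * corr f g t;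
    let J : X → ℝ := fun z => ∑ i : Fin N, P.bondCurrent N i z;
    ∀ b : Fin N, b.val + 1 < N →
      Filter.Tendsto (fun s => lap s (P.bondCurrent N b) J) (nhdsWithin (0 : ℝ) (Set.Ioi 0))
        (nhds ((∫ t in Set.Ioi (0 : ℝ), corr J J t) / ((N : ℝ) - 1))) := by
  intro hFI ω₂ lam β γ hω hl hβ hγ T hT N hN
  obtain ⟨-, hFI2, -, -⟩ := hFI ω₂ lam β γ hω hl hβ hγ T hT N hN
  intro P X μ corr lap J b hb
  exact RowLimit.tendsto_lap_bond (ω₂ := ω₂) (lam := lam) (β := β) (γ := γ) (N := N) (T := T)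
    (cov := fun f g => (∫ z, f z * g z ∂μ) - (∫ z, f z ∂μ) * (∫ z, g z ∂μ))
    (e := fun x z => z.2 x ^ 2 / 2 + P.U (z.1 x) +
      ∑ j : Fin N, ((if j.val = x.val + 1 then P.V (z.1 j - z.1 x) / 2 else 0) +
        (if x.val = j.val + 1 then P.V (z.1 x - z.1 j) / 2 else 0)))
    (fun f => Iff.rfl) (fun f g t => rfl) (fun s f g => rfl) (fun f g => rfl) (fun x z => rfl) hFI2
    (fun x z => generatorSiteEnergy_proof ω₂ lam β γ N hN T T x z) hω hl.le hβ.le hγ.le hT hN b hb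

end Summit.AtomisticToContinuum.FouriersLaw.Theorems.HonestZwanzig.PositiveMemory

end
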